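import Summits.Ventures.PercRepro.Night2LocalThmEFinal

/-!
# PercRepro — the «covering + pair» rule at `|E ∖ cl B| ≥ q + 1`: definitions, pair sets, rows (night-2, gen 14)

`localShadowHall_of_thin` (Night2LocalCover) proves the local form (LI_G) when every member `B` below `G` has
`|E ∖ cl B| ≥ q + 2`: the uniform covering weight `Φ/|E ∖ cl B| ≤ 1/(q+1)` on each covering set, at most `q + 1`
covering preimages per shadow set.  The companion file Night2LocalD2CoverPair lowers the threshold by one at the
flats with `|E ∖ G| ≤ q − 2` (**`localShadowHall_of_cover_pair`**: if every member `B` below `G` has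
`|E ∖ cl B| ≥ q + 1`, then (LI_G) holds); this file defines the rule and proves its row sums.

The matching (`cpW`): a member with `|E ∖ cl B| = q + 1`, hence `m := |G ∖ cl B| = q + 1 − |E ∖ G| ≥ 3`, takes
`1/(q+1)` from each of its `m` covering sets `B ∪ {z}` (`cpCov`) and `π_B := (m/(q+1)²) / C(m, 2)` from each of its
`C(m, 2)` pair sets `B ∪ {z, z'}`, `z ≠ z' ∈ G ∖ cl B` (`cpPair`) — row sum `m/(q+1) + m/(q+1)² = Φ·m/(q+1)`, its
local demand; every other member takes `Φ/|E ∖ cl B| ≤ 1/(q+1)` from each covering set (row sum = its demand).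
Columns: a shadow set `S` has at most `κ₀ := #coloops S ≤ q + 1` covering preimages, each of weight `≤ 1/(q+1)`,
and its pair preimages `B` have `S ∖ B` a series pair of `S` (`B ↦ S ∖ B` injective), each of weight
`π_B ≤ 1/(q+1)²` (as `m ≥ 3`); with `2·#seriesPairs ≤ (q+2−κ₀)(q+1−κ₀)` (`two_mul_card_seriesPairs_le`) the column
is at most `κ₀/(q+1) + (q+2−κ₀)(q+1−κ₀)/(2(q+1)²) ≤ 1`, the slack being `(q+1−κ₀)(κ₀+q)/(2(q+1)²) ≥ 0`.

Instance of record: `q = 4`, `|E ∖ G| = 2` — the (6,4) shadow row's last cell (`shadowHall_six_four_of_local_two`)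
at the rank-5 flats all of whose members have `|G ∖ cl B| ≥ 3`, i.e. whose carrying hyperplanes miss at least three
points of `G` (**`localShadowHall_d2_of_three_le`**); the members with `|G ∖ cl B| ≤ 2` (a coloop or a series pair of
`M|G` carrying members) remain the open cell.
-/

namespace PercRepro.Shadow

open Finset PerFlat ThmH

variable {α : Type*} [DecidableEq α] {M : Matroid α} [M.Finite]

/-! ## The rule -/

/-- The covering weight of the «covering + pair» rule: `1/(q+1)` for a member with `|E ∖ cl B| = q + 1`, else
`Φ/|E ∖ cl B|`. -/
noncomputable def cpCov (M : Matroid α) [M.Finite] (q : ℕ) (B : Finset α) : ℚ :=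
  if (gr M \ clF M B).card = q + 1 then 1 / ((q : ℚ) + 1)
  else (((q : ℚ) + 2) / ((q : ℚ) + 1)) / ((gr M \ clF M B).card : ℚ)

/-- The pair weight: `(m/(q+1)²) / C(m, 2)` with `m = |G ∖ cl B|` for a member with `|E ∖ cl B| = q + 1`, else `0`. -/
noncomputable def cpPair (M : Matroid α) [M.Finite] (q : ℕ) (G B : Finset α) : ℚ :=
  if (gr M \ clF M B).card = q + 1 then
    (((G \ clF M B).card : ℚ) / (((q : ℚ) + 1) ^ 2)) / (((G \ clF M B).card.choose 2 : ℕ) : ℚ)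
  else 0

open scoped Classical in
/-- The rule: `cpCov B` on the covering sets of `B`, `cpPair B` on each pair set `B ∪ P`, `P` a 2-subset of
`G ∖ cl B`; `0` for non-members. -/
noncomputable def cpW (M : Matroid α) [M.Finite] (q : ℕ) (G B S : Finset α) : ℚ :=
  (if B ∈ membersIn M (Uq M (q + 2) q) G ∧ S ∈ coverSets M B G then cpCov M q B else 0) +
  (if B ∈ membersIn M (Uq M (q + 2) q) G then
    ∑ P ∈ Finset.powersetCard 2 (G \ clF M B), (if S = B ∪ P then cpPair M q G B else 0) else 0)

/-! ## Basic facts -/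

/-- `cpCov ≥ 0`. -/
theorem cpCov_nonneg (q : ℕ) (B : Finset α) : 0 ≤ cpCov M q B := by
  unfold cpCov
  split_ifs <;> positivity

/-- `cpPair ≥ 0`. -/
theorem cpPair_nonneg (q : ℕ) (G B : Finset α) : 0 ≤ cpPair M q G B := by
  unfold cpPair
  split_ifs <;> positivity

open scoped Classical in
/-- `cpW ≥ 0`. -/
theorem cpW_nonneg (q : ℕ) (G B S : Finset α) : 0 ≤ cpW M q G B S := by
  unfold cpW
  apply add_nonneg
  · split_ifs
    · exact cpCov_nonneg q B
    · exact le_refl _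
  · split_ifs
    · apply Finset.sum_nonneg
      intro P _
      split_ifs
      · exact cpPair_nonneg q G B
      · exact le_refl _
    · exact le_refl _

/-- `|E ∖ cl B| = |G ∖ cl B| + |E ∖ G|` for `cl B ⊆ G ⊆ E`. -/
theorem card_sdiff_clF_eq_add {G B : Finset α} (hG : G ⊆ gr M) (hB : clF M B ⊆ G) :
    (gr M \ clF M B).card = (G \ clF M B).card + (gr M \ G).card := by
  have h1 : G \ clF M B ⊆ gr M \ clF M B := Finset.sdiff_subset_sdiff hG (le_refl _)
  have h2 : (gr M \ clF M B) \ (G \ clF M B) = gr M \ G := by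
    ext e
    simp only [Finset.mem_sdiff, not_and, not_not]
    constructor
    · rintro ⟨⟨he1, he2⟩, he3⟩
      exact ⟨he1, fun heG => he2 (he3 heG)⟩
    · rintro ⟨he1, he2⟩
      exact ⟨⟨he1, fun hcl => he2 (hB hcl)⟩, fun heG => absurd heG he2⟩
  have h3 := Finset.card_sdiff_add_card_eq_card h1
  rw [h2] at h3
  omega

/-- The covering weight of a member with `|E ∖ cl B| ≥ q + 1` is at most `1/(q+1)`. -/
theorem cpCov_le {q : ℕ} {B : Finset α} (h : q + 1 ≤ (gr M \ clF M B).card) :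
    cpCov M q B ≤ 1 / ((q : ℚ) + 1) := by
  unfold cpCov
  split_ifs with hc
  · exact le_refl _
  · have hc' : q + 2 ≤ (gr M \ clF M B).card := by omega
    have hcq : ((q : ℚ) + 2) ≤ ((gr M \ clF M B).card : ℚ) := by exact_mod_cast hc'
    have hq : (0 : ℚ) < (q : ℚ) + 1 := by positivity
    have hq2 : (0 : ℚ) < (q : ℚ) + 2 := by positivity
    have hcpos : (0 : ℚ) < ((gr M \ clF M B).card : ℚ) := by
      exact_mod_cast (by omega : 0 < (gr M \ clF M B).card)
    rw [div_div, div_le_div_iff₀ (mul_pos hq hcpos) hq, one_mul]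
    nlinarith

omit [DecidableEq α] in
/-- `m ≤ C(m, 2)` for `m ≥ 3`. -/
theorem le_choose_two {m : ℕ} (hm : 3 ≤ m) : m ≤ m.choose 2 := by
  rw [Nat.choose_two_right, Nat.le_div_iff_mul_le (by norm_num)]
  have : 2 ≤ m - 1 := by omega
  calc m * 2 ≤ m * (m - 1) := Nat.mul_le_mul_left m this
    _ = m * (m - 1) := rfl

/-- The pair weight of a member with `|G ∖ cl B| ≥ 3` is at most `1/(q+1)²`. -/
theorem cpPair_le {q : ℕ} {G B : Finset α} (hm : 3 ≤ (G \ clF M B).card) :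
    cpPair M q G B ≤ 1 / (((q : ℚ) + 1) ^ 2) := by
  unfold cpPair
  split_ifs with hc
  · set m := (G \ clF M B).card with hmdef
    have hmpos : (0 : ℚ) < (m : ℚ) := by exact_mod_cast (by omega : 0 < m)
    have hch : (m : ℚ) ≤ ((m.choose 2 : ℕ) : ℚ) := by exact_mod_cast le_choose_two hm
    have hq : (0 : ℚ) < ((q : ℚ) + 1) ^ 2 := by positivity
    have hchpos : (0 : ℚ) < ((m.choose 2 : ℕ) : ℚ) := lt_of_lt_of_le hmpos hch
    rw [div_div, div_le_div_iff₀ (mul_pos hq hchpos) hq, one_mul]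
    nlinarith
  · positivity

/-! ## Shadow sets: supersets inside `G` and the pair sets -/

/-- A superset inside `G` of a shadow set with closure `G` is a shadow set with closure `G`. -/
theorem insert_mem_shadowAt_of_mem {q : ℕ} {𝒜 : Finset (Finset α)} {G : Finset α}
    (hG : G ∈ flatsQ M (q + 1)) {S : Finset α} (hS : S ∈ shadowAt M (q + 2) q 𝒜 G) {z : α} (hzG : z ∈ G) :
    insert z S ∈ shadowAt M (q + 2) q 𝒜 G := by
  have hSG : S ⊆ G := subset_of_mem_shadowAt hS
  have hGg : G ⊆ gr M := (mem_flatsQ.1 hG).1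
  have hGfl : M.IsFlat (G : Set α) := (mem_flatsQ.1 hG).2.1
  have hGr : M.eRk (G : Set α) = ((q + 1 : ℕ) : ℕ∞) := (mem_flatsQ.1 hG).2.2
  rw [mem_shadowAt, mem_shadow] at hS
  obtain ⟨⟨hSY, B, hB, hBS⟩, hcl⟩ := hS
  have hsub : insert z S ⊆ G := Finset.insert_subset hzG hSG
  have hsubS : ((insert z S : Finset α) : Set α) ⊆ (G : Set α) := by exact_mod_cast hsub
  have hSr := eRk_eq_of_mem_Yq_diag hSY
  -- rank of the superset is `q + 1`
  have hr : M.eRk ((insert z S : Finset α) : Set α) = ((q + 1 : ℕ) : ℕ∞) := by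
    apply le_antisymm
    · rw [← hGr]; exact M.eRk_mono hsubS
    · rw [← hSr]
      exact M.eRk_mono (by exact_mod_cast Finset.subset_insert z S)
  have hY : insert z S ∈ Yq M (q + 2) q := by
    unfold Yq
    rw [Finset.mem_filter, Finset.mem_powerset, hr]
    refine ⟨hsub.trans hGg, ?_, ?_⟩
    · exact_mod_cast (by omega : q < q + 1)
    · exact_mod_cast (by omega : q + 1 < q + 2)
  rw [mem_shadowAt, mem_shadow]
  refine ⟨⟨hY, B, hB, hBS.trans (Finset.subset_insert z S)⟩, ?_⟩
  apply le_antisymm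
  · rw [← Finset.coe_subset, coe_clF]
    exact (M.closure_subset_closure hsubS).trans hGfl.closure.subset
  · rw [← hcl, ← Finset.coe_subset, coe_clF, coe_clF]
    exact M.closure_subset_closure (by exact_mod_cast Finset.subset_insert z S)

/-- A pair set `B ∪ P` of a member (`P` a 2-subset of `G ∖ cl B`) is a shadow set with closure `G`. -/
theorem union_pair_mem_shadowAt {q : ℕ} {𝒜 : Finset (Finset α)} (h𝒜 : 𝒜 ⊆ Uq M (q + 2) q) {G : Finset α}
    (hG : G ∈ flatsQ M (q + 1)) {B : Finset α} (hB : B ∈ membersIn M 𝒜 G) {P : Finset α}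
    (hP : P ∈ Finset.powersetCard 2 (G \ clF M B)) : B ∪ P ∈ shadowAt M (q + 2) q 𝒜 G := by
  rw [Finset.mem_powersetCard] at hP
  obtain ⟨hPsub, hPcard⟩ := hP
  obtain ⟨x, y, hxy, rfl⟩ := Finset.card_eq_two.1 hPcard
  have hx : x ∈ G \ clF M B := hPsub (by simp)
  have hy : y ∈ G \ clF M B := hPsub (by simp)
  have h1 : insert y B ∈ shadowAt M (q + 2) q 𝒜 G := insert_mem_shadowAt h𝒜 hG hB hy
  have h2 : insert x (insert y B) ∈ shadowAt M (q + 2) q 𝒜 G :=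
    insert_mem_shadowAt_of_mem hG h1 (Finset.mem_sdiff.1 hx).1
  have heq : B ∪ {x, y} = insert x (insert y B) := by
    ext e
    simp only [Finset.mem_union, Finset.mem_insert, Finset.mem_singleton]
    tauto
  rw [heq]
  exact h2

/-! ## Rows -/

open scoped Classical in
/-- The row sum of a member: `m · cpCov + C(m, 2) · cpPair`. -/
theorem sum_cpW_row {q : ℕ} {G : Finset α} (hG : G ∈ flatsQ M (q + 1)) {B : Finset α}
    (hB : B ∈ membersIn M (Uq M (q + 2) q) G) :
    ∑ S ∈ shadowAt M (q + 2) q (Uq M (q + 2) q) G, cpW M q G B S =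
      ((G \ clF M B).card : ℚ) * cpCov M q B + (((G \ clF M B).card.choose 2 : ℕ) : ℚ) * cpPair M q G B := by
  have hBU : B ∈ Uq M (q + 2) q := (mem_membersIn.1 hB).1
  unfold cpW
  rw [Finset.sum_add_distrib]
  congr 1
  · simp only [hB, true_and]
    rw [← Finset.sum_filter]
    have h1 : (shadowAt M (q + 2) q (Uq M (q + 2) q) G).filter (fun S => S ∈ coverSets M B G) =
        coverSets M B G := by
      ext S
      rw [Finset.mem_filter]
      exact ⟨fun h => h.2, fun h => ⟨coverSets_subset_shadowAt (le_refl _) hG hB h, h⟩⟩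
    rw [h1, Finset.sum_const, card_coverSets hBU, nsmul_eq_mul]
  · simp only [hB, if_true]
    rw [Finset.sum_comm]
    have h2 : ∀ P ∈ Finset.powersetCard 2 (G \ clF M B),
        ∑ S ∈ shadowAt M (q + 2) q (Uq M (q + 2) q) G, (if S = B ∪ P then cpPair M q G B else 0) =
          cpPair M q G B := by
      intro P hP
      rw [Finset.sum_ite_eq']
      simp only [union_pair_mem_shadowAt (le_refl _) hG hB hP, if_true]
    rw [Finset.sum_congr rfl h2, Finset.sum_const, Finset.card_powersetCard, nsmul_eq_mul]

/-- The row sum of a member with `|E ∖ cl B| ≥ q + 1` and `|G ∖ cl B| ≥ 3` dominates its local demand. -/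
theorem row_cpW_ge {q : ℕ} {G : Finset α} (hG : G ∈ flatsQ M (q + 1)) {B : Finset α}
    (hB : B ∈ membersIn M (Uq M (q + 2) q) G) (hc : q + 1 ≤ (gr M \ clF M B).card)
    (hm : 3 ≤ (G \ clF M B).card) :
    (((q : ℚ) + 2) / ((q : ℚ) + 1)) * localWeight M B G ≤
      ∑ S ∈ shadowAt M (q + 2) q (Uq M (q + 2) q) G, cpW M q G B S := by
  classical
  rw [sum_cpW_row hG hB]
  unfold localWeight cpCov cpPair
  set m := (G \ clF M B).card with hmdef
  set c := (gr M \ clF M B).card with hcdef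
  have hq : (0 : ℚ) < (q : ℚ) + 1 := by positivity
  split_ifs with h
  · -- `c = q + 1`: `m/(q+1) + m/(q+1)² = Φ · m/(q+1)`
    have hch : (m.choose 2 : ℚ) ≠ 0 := by
      have := le_choose_two hm
      exact_mod_cast (by omega : m.choose 2 ≠ 0)
    rw [h]
    push_cast
    rw [mul_div_assoc', mul_div_cancel₀ _ hch]
    field_simp
    ring_nf
    exact le_refl _
  · -- `c ≥ q + 2`: `m · Φ/c = Φ · m/c`
    have hc0 : (c : ℚ) ≠ 0 := by
      have : 0 < c := by omega
      exact_mod_cast this.ne'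
    rw [mul_zero, add_zero]
    field_simp
    ring_nf
    exact le_refl _

end PercRepro.Shadow
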